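import Summits.Ventures.PercRepro.Night2FatXSources

/-!
# night-2: the line of a loaded target above `Q ∪ {x}` avoids the two off-points; the smallest fat cell is closed

With the fat split `G ∖ clF B₀ = {w₀, x}`, the rank-2 part `R` of the source of a loaded target never contains `w₀`
or `x`: the source contains at most one of them (`notMem_or_notMem_insert_of_loss_ne_zero`), and if it contained the
other as a point of `R`, two further points of `R` would lie in `clF B₀` and span `R` — so `R ⊆ clF B₀`, a
contradiction.  Hence (`exists_line_of_dload_ne_zero_fat`) `R ⊆ (T ∖ K) ∖ {w₀, x}` with `|R| ≥ 3` and
`|T ∖ K| ≤ |R| + 5`; above a basis pair (`loaded_fat_target_line`) `|T ∖ Q| ≤ |R|`, and since the basis points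
off `w₀` are independent, `|R ∩ Q| ≤ 2`: all but at most one point of `Y = T ∖ Q ∖ {x}` lie on the line `R`
(`card_sdiff_le_card_sdiff_add_two_of_loaded_fat`).

With `four_le_rkN_sdiff_insert_of_loss_ne_zero` this closes the smallest fat cell: at `N = |G ∖ Q| = 4` (`|G| = 10`)
no target above `Q ∪ {x}` is loaded (level `1`: six points off `K`; level `2`: a distance-1 target needs
`rk (G ∖ T) ≥ 3 > |G ∖ T| = 2`; levels `3`, `4`: `|G ∖ T| ≤ 1`), so `basis_pair_fair_fat_of_unloaded` applies:
**`localShadowHall_fat_of_card_eq_ten`**.  Paper `proofs/NIGHT-2-g33.md` §2–§3.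
-/

namespace PercRepro.Shadow

open PercRepro.ThmH PercRepro.PerFlat

variable {α : Type*} [DecidableEq α] {M : Matroid α} [M.Finite] {G : Finset α}

/-- A set of rank at most `2` with two distinct points in `clF B₀` lies in `clF B₀`. -/
theorem subset_clF_of_rkN_le_two_of_two_mem (hs : ∀ e ∈ gr M, ∀ f ∈ gr M, e ≠ f → rkN M {e, f} = 2)
    {R : Finset α} (hR : R ⊆ gr M) (h2 : rkN M R ≤ 2) {r₁ r₂ : α} (hr₁ : r₁ ∈ R) (hr₂ : r₂ ∈ R)
    (hne : r₁ ≠ r₂) {B₀ : Finset α} (h₁ : r₁ ∈ clF M B₀) (h₂ : r₂ ∈ clF M B₀) : R ⊆ clF M B₀ := by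
  have hsub := subset_clF_pair_of_rkN_le_two hs hR h2 hr₁ hr₂ hne
  have hpair : ({r₁, r₂} : Finset α) ⊆ clF M B₀ := by
    intro e he
    rw [Finset.mem_insert, Finset.mem_singleton] at he
    rcases he with rfl | rfl
    · exact h₁
    · exact h₂
  exact hsub.trans (clF_subset_clF_of_subset_clF hpair)

/-- **The line of a loaded target avoids the off-points** `w₀, x` of the fat closure: a loaded `T ⊆ G` contains a
rank-`2` set `R ⊆ (T ∖ K) ∖ {w₀, x}` with `|R| ≥ 3` and `|T ∖ K| ≤ |R| + 5`. -/
theorem exists_line_of_dload_ne_zero_fat (hG : G ∈ flatsQ M (5 + 1)) (hd : (gr M \ G).card = 2)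
    (hk : kColoops M G = 1) (hs : ∀ e ∈ gr M, ∀ f ∈ gr M, e ≠ f → rkN M {e, f} = 2)
    (hl : ∀ e ∈ gr M, M.Indep {e}) (hfat : (fatClosures M 5 G 2).card ≤ 1) {B₀ : Finset α}
    (hB₀ : B₀ ∈ thinMembers M 5 G) {w₀ x : α} (hD : G \ clF M B₀ = {w₀, x}) {T : Finset α} (hTG : T ⊆ G)
    (hload : dload M 5 G (bigP M G) (dshGT2 M 5 G) T ≠ 0) :
    ∃ R ⊆ (T \ coloops M G) \ {w₀, x}, rkN M R = 2 ∧ 3 ≤ R.card ∧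
      (T \ coloops M G).card ≤ R.card + 5 := by
  obtain ⟨B', hB', hbig, z', hz', hloss, hcase⟩ := exists_pair_of_dload_ne_zero' hG hd hk hs hl hfat hload
  obtain ⟨R, hRQ, hR2, hRcard⟩ := exists_rank_two_of_loss_ne_zero hG hd hk hs hl hB' hbig hz' hloss
  have hd' : (gr M \ G).card ≤ 5 := by omega
  have hKB' : coloops M G ⊆ B' := coloops_subset_of_mem_thinMembers hG hd' hB'
  have hB'G : B' ⊆ G := subset_G_of_mem_thinMembers hB'
  have hzB' : z' ∉ B' := fun h => (Finset.mem_sdiff.1 hz').2 (subset_clF_of_subset_gr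
    (hB'G.trans (mem_flatsQ.1 hG).1) h)
  have hzK : z' ∉ coloops M G := fun h => hzB' (hKB' h)
  -- the source lies in `T`, and `T` has at most two more points off `K`
  have hQ'T : insert z' B' ⊆ T := by
    rcases hcase with ⟨-, x', -, rfl⟩ | ⟨-, p, -, rfl⟩
    · exact Finset.subset_insert _ _
    · exact (Finset.subset_insert _ _).trans (Finset.subset_insert _ _)
  have hTK : (T \ coloops M G).card ≤ (insert z' B' \ coloops M G).card + 2 := by
    rcases hcase with ⟨-, x', -, rfl⟩ | ⟨-, p, -, rfl⟩
    · have hsub : insert x' (insert z' B') \ coloops M G ⊆ insert x' (insert z' B' \ coloops M G) := by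
        intro e he
        rw [Finset.mem_sdiff, Finset.mem_insert] at he
        rw [Finset.mem_insert, Finset.mem_sdiff]
        rcases he.1 with h | h
        · exact Or.inl h
        · exact Or.inr ⟨h, he.2⟩
      have h1 := Finset.card_le_card hsub
      have h2 := Finset.card_insert_le x' (insert z' B' \ coloops M G)
      omega
    · have hsub : insert p.1 (insert p.2 (insert z' B')) \ coloops M G ⊆
          insert p.1 (insert p.2 (insert z' B' \ coloops M G)) := by
        intro e he
        rw [Finset.mem_sdiff, Finset.mem_insert, Finset.mem_insert] at he
        rw [Finset.mem_insert, Finset.mem_insert, Finset.mem_sdiff]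
        rcases he.1 with h | h | h
        · exact Or.inl h
        · exact Or.inr (Or.inl h)
        · exact Or.inr (Or.inr ⟨h, he.2⟩)
      have h1 := Finset.card_le_card hsub
      have h2 := Finset.card_insert_le p.1 (insert p.2 (insert z' B' \ coloops M G))
      have h3 := Finset.card_insert_le p.2 (insert z' B' \ coloops M G)
      omega
  have hQ'6 : 6 ≤ (insert z' B' \ coloops M G).card := by
    have heq : insert z' B' \ coloops M G = insert z' (B' \ coloops M G) := by
      ext e
      simp only [Finset.mem_sdiff, Finset.mem_insert]
      constructor
      · rintro ⟨h | h, h2⟩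
        · exact Or.inl h
        · exact Or.inr ⟨h, h2⟩
      · rintro (rfl | ⟨h, h2⟩)
        · exact ⟨Or.inl rfl, hzK⟩
        · exact ⟨Or.inr h, h2⟩
    rw [heq, Finset.card_insert_of_notMem (fun h => hzB' (Finset.mem_sdiff.1 h).1)]
    omega
  have hR3 : 3 ≤ R.card := by omega
  have hRT : R ⊆ T \ coloops M G := hRQ.trans (Finset.sdiff_subset_sdiff hQ'T (Finset.Subset.refl _))
  have hRG : R ⊆ G := hRT.trans (Finset.sdiff_subset.trans hTG)
  have hRgr : R ⊆ gr M := hRG.trans (mem_flatsQ.1 hG).1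
  have hoff := notMem_or_notMem_insert_of_loss_ne_zero hG hd hk hs hl hB₀ hD hB' hbig hz' hloss
  -- if the other off-point is outside the source, this one is not on the line
  have key : ∀ u v : α, ({w₀, x} : Finset α) = {u, v} → v ∉ insert z' B' → u ∉ R := by
    intro u v huv hvQ huR
    have hu : u ∈ G \ clF M B₀ := by
      rw [hD, huv]
      exact Finset.mem_insert_self _ _
    have h2 : 1 < (R.erase u).card := by
      rw [Finset.card_erase_of_mem huR]
      omega
    obtain ⟨r₁, hr₁, r₂, hr₂, hne⟩ := Finset.one_lt_card.1 h2
    have hcl : ∀ r ∈ R.erase u, r ∈ clF M B₀ := by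
      intro r hr
      rw [Finset.mem_erase] at hr
      by_contra hc
      have hmem : r ∈ G \ clF M B₀ := Finset.mem_sdiff.2 ⟨hRG hr.2, hc⟩
      rw [hD, huv, Finset.mem_insert, Finset.mem_singleton] at hmem
      rcases hmem with rfl | rfl
      · exact hr.1 rfl
      · exact hvQ (Finset.mem_sdiff.1 (hRQ hr.2)).1
    have hsub := subset_clF_of_rkN_le_two_of_two_mem hs hRgr (by omega) (Finset.mem_of_mem_erase hr₁)
      (Finset.mem_of_mem_erase hr₂) hne (hcl r₁ hr₁) (hcl r₂ hr₂)
    exact (Finset.mem_sdiff.1 hu).2 (hsub huR)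
  have hw₀R : w₀ ∉ R := by
    rcases hoff with h | h
    · exact fun hw => h (Finset.mem_sdiff.1 (hRQ hw)).1
    · exact key w₀ x rfl h
  have hxR : x ∉ R := by
    rcases hoff with h | h
    · exact key x w₀ (Finset.pair_comm _ _) h
    · exact fun hx => h (Finset.mem_sdiff.1 (hRQ hx)).1
  refine ⟨R, ?_, hR2, hR3, by omega⟩
  intro r hr
  rw [Finset.mem_sdiff, Finset.mem_insert, Finset.mem_singleton]
  refine ⟨hRT hr, ?_⟩
  rintro (rfl | rfl)
  · exact hw₀R hr
  · exact hxR hr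

/-- `|G ∖ T| + |T ∖ Q| = |G ∖ Q|` at a target of a basis pair. -/
theorem card_sdiff_add_card_sdiff_of_mem_tgtSets {B : Finset α} {z : α} {T : Finset α}
    (hT : T ∈ tgtSets M 5 G B z) :
    (G \ T).card + (T \ insert z B).card = (G \ insert z B).card := by
  have hTG : T ⊆ G := subset_G_of_mem_shadowAt (mem_tgtSets.1 hT).1
  have hQT : insert z B ⊆ T := (mem_tgtSets.1 hT).2.1
  have h1 : G \ insert z B = (G \ T) ∪ (T \ insert z B) := by
    ext e
    simp only [Finset.mem_sdiff, Finset.mem_union]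
    constructor
    · rintro ⟨heG, heQ⟩
      by_cases heT : e ∈ T
      · exact Or.inr ⟨heT, heQ⟩
      · exact Or.inl ⟨heG, heT⟩
    · rintro (⟨heG, heT⟩ | ⟨heT, heQ⟩)
      · exact ⟨heG, fun h => heT (hQT h)⟩
      · exact ⟨hTG heT, heQ⟩
  have hdisj : Disjoint (G \ T) (T \ insert z B) := by
    rw [Finset.disjoint_left]
    intro e h1 h2
    exact (Finset.mem_sdiff.1 h1).2 (Finset.mem_sdiff.1 h2).1
  rw [h1, Finset.card_union_of_disjoint hdisj]

/-- **The line of a loaded target above a basis pair**: `R ⊆ (T ∖ K) ∖ {w₀, x}` of rank `2` with `|R| ≥ 3` and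
`|T ∖ Q| ≤ |R|`. -/
theorem loaded_fat_target_line (hG : G ∈ flatsQ M (5 + 1)) (hd : (gr M \ G).card = 2)
    (hk : kColoops M G = 1) (hs : ∀ e ∈ gr M, ∀ f ∈ gr M, e ≠ f → rkN M {e, f} = 2)
    (hl : ∀ e ∈ gr M, M.Indep {e}) (hfat : (fatClosures M 5 G 2).card ≤ 1) {B₀ : Finset α}
    (hB₀ : B₀ ∈ thinMembers M 5 G) {w₀ x : α} (hD : G \ clF M B₀ = {w₀, x}) {B : Finset α}
    (hB : B ∈ thinMembers M 5 G) (hnP : ¬ bigP M G B) {z : α} (hz : z ∈ G \ clF M B) {T : Finset α}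
    (hT : T ∈ tgtSets M 5 G B z) (hload : dload M 5 G (bigP M G) (dshGT2 M 5 G) T ≠ 0) :
    ∃ R ⊆ (T \ coloops M G) \ {w₀, x}, rkN M R = 2 ∧ 3 ≤ R.card ∧ (T \ insert z B).card ≤ R.card := by
  have hTG : T ⊆ G := subset_G_of_mem_shadowAt (mem_tgtSets.1 hT).1
  obtain ⟨R, hR, hR2, hR3, hRc⟩ := exists_line_of_dload_ne_zero_fat hG hd hk hs hl hfat hB₀ hD hTG hload
  have := card_sdiff_coloops_eq_level_add_five hG hd hk hB hnP hz hT
  exact ⟨R, hR, hR2, hR3, by omega⟩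

/-- **All but at most one point of `T ∖ Q` lie on the line** of a loaded target above `Q ∪ {x}`: with `w₀ ∈ Q`
the line `R` meets `Q` in at most two points (the basis points off `w₀` are independent), so
`|T ∖ Q| ≤ |R ∖ Q| + 2`. -/
theorem card_sdiff_le_card_sdiff_add_two_of_loaded_fat (hG : G ∈ flatsQ M (5 + 1)) (hd : (gr M \ G).card = 2)
    (hk : kColoops M G = 1) {B : Finset α} (hB : B ∈ thinMembers M 5 G) (hnP : ¬ bigP M G B) {z : α}
    (hz : z ∈ G \ clF M B) {T : Finset α} {R : Finset α}
    (hR : R ⊆ T \ coloops M G) (hR2 : rkN M R = 2) (hRc : (T \ insert z B).card ≤ R.card) :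
    (T \ insert z B).card ≤ (R \ insert z B).card + 2 := by
  have hQ5 := card_insert_sdiff_eq_five hG hd hk hB hnP hz
  have hrk5 := rkN_insert_sdiff_coloops_eq_five_of_thin hG hd hk hB hz
  have hind : M.Indep ((insert z B \ coloops M G : Finset α) : Set α) :=
    indep_of_rkN_eq_card (by rw [hrk5, hQ5])
  have hsub : R ∩ insert z B ⊆ insert z B \ coloops M G := by
    intro e he
    rw [Finset.mem_inter] at he
    exact Finset.mem_sdiff.2 ⟨he.2, (Finset.mem_sdiff.1 (hR he.1)).2⟩
  have hind' : M.Indep ((R ∩ insert z B : Finset α) : Set α) := hind.subset (by exact_mod_cast hsub)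
  have h1 : rkN M (R ∩ insert z B) = (R ∩ insert z B).card := rkN_eq_card_of_indep hind'
  have h2 : rkN M (R ∩ insert z B) ≤ rkN M R := rkN_mono Finset.inter_subset_left
  have h3 := Finset.card_sdiff_add_card_inter R (insert z B)
  omega

/-- **At `N = |G ∖ Q| = 4` no target above `Q ∪ {x}` is loaded.** -/
theorem dload_eq_zero_of_card_sdiff_eq_four (hG : G ∈ flatsQ M (5 + 1)) (hd : (gr M \ G).card = 2)
    (hk : kColoops M G = 1) (hs : ∀ e ∈ gr M, ∀ f ∈ gr M, e ≠ f → rkN M {e, f} = 2)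
    (hl : ∀ e ∈ gr M, M.Indep {e}) (hfat : (fatClosures M 5 G 2).card ≤ 1) {B : Finset α}
    (hB : B ∈ thinMembers M 5 G) (hnP : ¬ bigP M G B) {z : α} (hz : z ∈ G \ clF M B)
    (hN : (G \ insert z B).card = 4) {T : Finset α} (hT : T ∈ tgtSets M 5 G B z) :
    dload M 5 G (bigP M G) (dshGT2 M 5 G) T = 0 := by
  have hlev := card_sdiff_coloops_eq_level_add_five hG hd hk hB hnP hz hT
  have hGT := card_sdiff_add_card_sdiff_of_mem_tgtSets hT
  rcases Nat.lt_or_ge (T \ insert z B).card 2 with h1 | h2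
  · exact dload_eq_zero_of_card_sdiff_le_six hG hd hk hs hl (by omega)
  · rcases Nat.lt_or_ge (T \ insert z B).card 3 with h2' | h3
    · by_contra hne
      have := three_le_rkN_sdiff_of_dload_ne_zero_of_card_le_seven hG hd hk hs hl hfat (by omega) hne
      have := rkN_le_card (M := M) (G \ T)
      omega
    · exact dload_eq_zero_of_card_sdiff_le_one hG hd hk hs hl hfat (by omega)

/-- **The fat case of (FAIR) at `N = 4`.** -/
theorem basis_pair_fair_fat_of_card_sdiff_eq_four (hG : G ∈ flatsQ M (5 + 1)) (hd : (gr M \ G).card = 2)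
    (hk : kColoops M G = 1) (hs : ∀ e ∈ gr M, ∀ f ∈ gr M, e ≠ f → rkN M {e, f} = 2)
    (hl : ∀ e ∈ gr M, M.Indep {e}) (hfat : (fatClosures M 5 G 2).card ≤ 1)
    {B₀ : Finset α} (hB₀ : B₀ ∈ thinMembers M 5 G) {w₀ x : α} (hD : G \ clF M B₀ = {w₀, x}) (hne : w₀ ≠ x)
    {B : Finset α} (hB : B ∈ thinMembers M 5 G) (hnP : ¬ bigP M G B) {z : α} (hz : z ∈ G \ clF M B)
    (hl0 : loss M 5 G B z ≠ 0) (hw₀ : w₀ ∈ insert z B) (hx : x ∉ insert z B)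
    (hN : (G \ insert z B).card = 4) :
    loss M 5 G B z ≤ rhoL M 5 G B z * lossIncomeH M 5 G (bigP M G) (dshGT2 M 5 G) B z :=
  basis_pair_fair_fat_of_unloaded hG hd hk hs hl hfat hB₀ hD hne hB hnP hz hl0 hw₀ hx
    (fun _ hT _ => dload_eq_zero_of_card_sdiff_eq_four hG hd hk hs hl hfat hB hnP hz hN hT)

/-- **The smallest (2,1) cell with a fat closure is closed**: `|G| = 10` gives `LocalShadowHall M 5 G`. -/
theorem localShadowHall_fat_of_card_eq_ten (hG : G ∈ flatsQ M (5 + 1)) (hd : (gr M \ G).card = 2)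
    (hk : kColoops M G = 1) (hs : ∀ e ∈ gr M, ∀ f ∈ gr M, e ≠ f → rkN M {e, f} = 2)
    (hl : ∀ e ∈ gr M, M.Indep {e}) (hfat : (fatClosures M 5 G 2).card ≤ 1)
    {B₀ : Finset α} (hB₀ : B₀ ∈ thinMembers M 5 G) (hm₀ : (G \ clF M B₀).card = 2) (hG10 : G.card = 10) :
    LocalShadowHall M 5 G := by
  apply localShadowHall_of_gt2_of_basis_fair hG hd hk hs hl hfat
  intro B hB hnP z hz
  have hd' : (gr M \ G).card ≤ 5 := by omega
  by_cases hl0 : loss M 5 G B z = 0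
  · rw [hl0]
    have h1 : 0 ≤ rhoL M 5 G B z := by
      unfold rhoL
      rw [hl0]
      simp
    have h2 : 0 ≤ lossIncomeH M 5 G (bigP M G) (dshGT2 M 5 G) B z :=
      lossIncomeH_nonneg hG hd' (column_side_gt2 hG hd hk hs hl hfat) B z
    positivity
  · obtain ⟨w₀, x, hD, hne, hw₀, hx⟩ := exists_fat_split hG hd hk hB₀ hm₀ hB hz hl0
    have hN : (G \ insert z B).card = 4 := by
      have hQG : insert z B ⊆ G :=
        Finset.insert_subset (Finset.mem_sdiff.1 hz).1 (subset_G_of_mem_thinMembers hB)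
      have hKQ : coloops M G ⊆ insert z B :=
        (coloops_subset_of_mem_thinMembers hG hd' hB).trans (Finset.subset_insert _ _)
      have hQ5 := card_insert_sdiff_eq_five hG hd hk hB hnP hz
      have h1 := Finset.card_sdiff_add_card_eq_card hKQ
      rw [← kColoops_eq_card_coloops, hk, hQ5] at h1
      have h2 := Finset.card_sdiff_add_card_eq_card hQG
      omega
    exact basis_pair_fair_fat_of_card_sdiff_eq_four hG hd hk hs hl hfat hB₀ hD hne hB hnP hz hl0 hw₀ hx hN

end PercRepro.Shadow
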